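import Mathlib
import HarnessLib
import Summits.HubbardSuperconductivity.HubbardSuperconductivity.Theorems.KLProgrammeFermiSurfaceSharpWindow

/-!
# Route `KLProgramme` (K1 `H10TwoPointLimit`, K3 `KLRegimeTwoPointLimit`) — the SHARP `BandBounds` bundle:
# Lean-certified NUMBERS on the ANALYSIS window `μ ∈ [-1, -0.15]` of the leaf (`δ ∈ [0.10, 0.35]`, S0 `MuOfDopingWindow`)

Cell `gate-hubbard-kl`, seat fs-1 (g5), risk r2 (serving r1 «explicit constants»). The leaf of record
`…Theses.WeakCouplingBCS.H1TwoPointLimitKLScaleD` quantifies over `δ ∈ [0.10, 0.35]`, which S0 (`muOfDopingWindow_proof`,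
stmt-HubbardSuperconductivity-19939) places at `μ(δ) ∈ [-1, -0.15]` = `KLRegimeSplit.klWindow`, the window of K1/K3. This file is
the companion of `KLProgrammeFermiSurfaceSharpWindow.lean` (certified window `[-0.4267, -0.1798]`) on THAT window: numeric
corollaries of `klfs_exists_sharpBandBounds` at `a = -1`, `b = -0.15`. Transcendental inputs: `d_a = arccos(1/4) ≥ 1.318`
(`cos 1.318 = sin(π/2 - 1.318) > 0.2501`), `sin d_a = √15/4` exactly, `K_b = arccos(-0.925) ≤ 2.76`
(`cos(π - 2.76) ≥ 1 - (π - 2.76)²/2 > 0.927`); the rest is rational arithmetic with `√2`, `√0.5775`, `√31.955`.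
Result (`klfs_analysisWindow_sharpBandBounds`): a `BandBounds (-1) (-0.15)` with
  `umin ≥ 1.86`, `smax ≤ 3.91`, `A2 ≤ 36.2`, `hmin ≥ 0.138`, `amin ≥ 0.0494`, `rhomin ≥ 0.3799`, `cmax ≤ 0.735`,
  `Dtmin ≥ 0.537`, **`C_g ≤ 162`**, `Dcell ≤ 3.82`
(certified values, kit j252652 row «analysis window», FS-WINDOW.md §6a: `1.8641`, `3.8917`, `35.968`, `0.1388`, `0.049464`,
`0.37997`, `0.73457`, `0.53735`, `161.57`, `3.8068`; the tree's generic bundle `bandBounds (-1) (-0.15)` on the same window: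
`C_g = 1.63·10⁵`, `A2 = 1273`, `smax = 19.5`, `amin = 1.9·10⁻⁴`, `Dcell = 11.8`). Use: the perturbation thresholds
`κ* = min(h_min, a_min, Dt_min, …)/(2C)` of the moving-curve sector count on K1's window (HOME/prover-p4/PORT-NOTE.md §3) are
read off these fields. No definitions; everything PROVED. [folklore]
-/

noncomputable section

open Real Set

-- the tree's namespace `Summit.<Summit>.<Problem>.Theorems` repeats the summit name by design (D-0017)
set_option linter.dupNamespace false

namespace Summit.HubbardSuperconductivity.HubbardSuperconductivity.Theorems

open Literature.MathematicalPhysics.QuantumLattice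
open Literature.MathematicalPhysics.QuantumLattice.BandSectorCounting

/-! ### §1 The numeric inputs on `[a, b] = [-1, -0.15]` -/

/-- **`d_a = arccos(1/4) ≥ 1.318`** (`cos 1.318 = sin(π/2 - 1.318) > 0.2501 > 1/4`). [folklore] -/
theorem klfs_numA_arccos_da_ge : (1.318 : ℝ) ≤ Real.arccos (-(-1 : ℝ) / 4) := by
  have hπ1 := Real.pi_gt_d6
  have hπ2 := Real.pi_lt_d6
  set x : ℝ := π / 2 - 1.318 with hx
  have hx1 : (0.252796 : ℝ) ≤ x := by rw [hx]; linarith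
  have hx2 : x ≤ (0.252797 : ℝ) := by rw [hx]; linarith
  have hx0 : 0 < x := by linarith
  have hsin : x - x ^ 3 / 6 < Real.sin x := Real.sin_gt_sub_cube hx0
  have hx3 : x ^ 3 ≤ (0.252797 : ℝ) ^ 3 := pow_le_pow_left₀ hx0.le hx2 3
  have hcos : Real.cos 1.318 = Real.sin x := by rw [hx, Real.sin_pi_div_two_sub]
  have hval : (-(-1 : ℝ) / 4) ≤ Real.cos 1.318 := by rw [hcos]; norm_num at hx3 ⊢; linarith
  have h := Real.antitone_arccos hval
  rwa [Real.arccos_cos (by norm_num) (by linarith)] at h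

/-- `d_a ≤ π/2 < 1.5708`. [folklore] -/
theorem klfs_numA_arccos_da_le : Real.arccos (-(-1 : ℝ) / 4) ≤ 1.5708 := by
  have h := Real.arccos_lt_pi_div_two.2 (show (0 : ℝ) < -(-1 : ℝ) / 4 by norm_num)
  have hπ2 := Real.pi_lt_d6
  linarith

/-- **`sin d_a = √15/4 ≤ 0.96825`** (`sin(arccos x) = √(1 - x²)`). [folklore] -/
theorem klfs_numA_sin_da_le : Real.sin (Real.arccos (-(-1 : ℝ) / 4)) ≤ 0.96825 := by
  rw [Real.sin_arccos, Real.sqrt_le_left (by norm_num)]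
  norm_num

/-- **`K_b = arccos(-0.925) ≤ 2.76`** (`cos(π - 2.76) ≥ 1 - (π - 2.76)²/2 > 0.927 > 0.925`). [folklore] -/
theorem klfs_numA_umklappRadius_b_le : umklappRadius (-0.15) ≤ 2.76 := by
  have hπ1 := Real.pi_gt_d6
  have hπ2 := Real.pi_lt_d6
  set x : ℝ := π - 2.76 with hx
  have hx1 : (0.381592 : ℝ) ≤ x := by rw [hx]; linarith
  have hx2 : x ≤ (0.381593 : ℝ) := by rw [hx]; linarith
  have hc : 1 - x ^ 2 / 2 ≤ Real.cos x := Real.one_sub_sq_div_two_le_cos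
  have hx22 : x ^ 2 ≤ (0.381593 : ℝ) ^ 2 := pow_le_pow_left₀ (by linarith) hx2 2
  have hcos : Real.cos 2.76 = -Real.cos x := by
    rw [hx, Real.cos_pi_sub, neg_neg]
  have hval : Real.cos 2.76 ≤ -(-0.15 : ℝ) / 2 - 1 := by rw [hcos]; norm_num at hx22 ⊢; linarith
  have h := Real.antitone_arccos hval
  rw [Real.arccos_cos (by norm_num) (by linarith)] at h
  exact h

/-- `0.3799 ≤ s_* = min(s_a, s_b)` and `s_* ≤ s_b ≤ 0.38` on the analysis window (`s_a = √3/2`, `s_b = √0.5775/2`). [folklore] -/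
theorem klfs_numA_levelSin_min :
    (0.3799 : ℝ) ≤ min (Real.sqrt (-(-1 : ℝ) * (4 + -1)) / 2) (Real.sqrt (-(-0.15 : ℝ) * (4 + -0.15)) / 2) ∧
    min (Real.sqrt (-(-1 : ℝ) * (4 + -1)) / 2) (Real.sqrt (-(-0.15 : ℝ) * (4 + -0.15)) / 2) ≤ 0.38 := by
  have ha : (0.866 : ℝ) ≤ Real.sqrt (-(-1 : ℝ) * (4 + -1)) / 2 := by
    rw [le_div_iff₀ (by norm_num : (0:ℝ) < 2), Real.le_sqrt (by norm_num) (by norm_num)]; norm_num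
  have hb : (0.3799 : ℝ) ≤ Real.sqrt (-(-0.15 : ℝ) * (4 + -0.15)) / 2 := by
    rw [le_div_iff₀ (by norm_num : (0:ℝ) < 2), Real.le_sqrt (by norm_num) (by norm_num)]; norm_num
  have hb' : Real.sqrt (-(-0.15 : ℝ) * (4 + -0.15)) / 2 ≤ 0.38 := by
    rw [div_le_iff₀ (by norm_num : (0:ℝ) < 2), Real.sqrt_le_left (by norm_num)]; norm_num
  exact ⟨le_min (by linarith) hb, (min_le_right _ _).trans hb'⟩

/-- `0.02653 ≤ κ_b = 0.15/√(32 - 2·0.15²)`. [folklore] -/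
theorem klfs_numA_kappa_b_ge : (0.02653 : ℝ) ≤ -(-0.15 : ℝ) / Real.sqrt (32 - 2 * (-0.15 : ℝ) ^ 2) := by
  have hs : Real.sqrt (32 - 2 * (-0.15 : ℝ) ^ 2) ≤ 5.653 := by
    rw [Real.sqrt_le_left (by norm_num)]; norm_num
  have hs0 : 0 < Real.sqrt (32 - 2 * (-0.15 : ℝ) ^ 2) := Real.sqrt_pos.2 (by norm_num)
  rw [le_div_iff₀ hs0]
  nlinarith

/-- `0.07489 ≤ min(n_a, n_b)` (`n_μ = (-μ/2)(1 - μ²/16)`; the minimum is `n_b = 0.074894…`). [folklore] -/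
theorem klfs_numA_levelN_min_ge :
    (0.07489 : ℝ) ≤ min (-(-1 : ℝ) / 2 * (1 - (-1 : ℝ) ^ 2 / 16)) (-(-0.15 : ℝ) / 2 * (1 - (-0.15 : ℝ) ^ 2 / 16)) :=
  le_min (by norm_num) (by norm_num)

/-- `sin d_a / d_a ≤ 0.96825/1.318 < 0.735`. [folklore] -/
theorem klfs_numA_sinc_da_le : Real.sin (Real.arccos (-(-1 : ℝ) / 4)) / Real.arccos (-(-1 : ℝ) / 4) ≤ 0.735 := by
  have hd := klfs_numA_arccos_da_ge
  have hd0 : 0 < Real.arccos (-(-1 : ℝ) / 4) := by linarith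
  rw [div_le_iff₀ hd0]
  have := klfs_numA_sin_da_le
  nlinarith

/-- `0 < sin d_a / d_a`. [folklore] -/
theorem klfs_numA_sinc_da_pos : 0 < Real.sin (Real.arccos (-(-1 : ℝ) / 4)) / Real.arccos (-(-1 : ℝ) / 4) := by
  have hd := klfs_numA_arccos_da_ge
  have hdle := klfs_numA_arccos_da_le
  have hd0 : 0 < Real.arccos (-(-1 : ℝ) / 4) := by linarith
  exact div_pos (Real.sin_pos_of_pos_of_lt_pi hd0 (by linarith [Real.pi_gt_d6])) hd0

/-! ### §2 The numbers of the sharp bundle on the analysis window -/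

/-- **The SHARP bundle on the analysis window `μ ∈ [-1, -0.15]` (the leaf's window) with its constants as numbers**:
`umin ≥ 1.86`, `smax ≤ 3.91`, `A2 ≤ 36.2`, `hmin ≥ 0.138`, `amin ≥ 0.0494`, `rhomin ≥ 0.3799`, `cmax ≤ 0.735`,
`Dtmin ≥ 0.537`, `C_g ≤ 162`, `Dcell ≤ 3.82` (generic `bandBounds` on the same range: `umin = 1.73`, `smax = 19.5`,
`A2 = 1273`, `hmin = 0.0527`, `amin = 1.9·10⁻⁴`, `rhomin = 0.239`, `cmax = 1.15`, `Dtmin = 0.478`, `C_g = 163 040`,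
`Dcell = 11.8`). [folklore] -/
theorem klfs_analysisWindow_sharpBandBounds :
    ∃ B : BandBounds (-1) (-0.15),
      1.86 ≤ B.umin ∧ B.smax ≤ 3.91 ∧ B.A2 ≤ 36.2 ∧ 0.138 ≤ B.hmin ∧ 0.0494 ≤ B.amin ∧ 0.3799 ≤ B.rhomin ∧
      B.cmax ≤ 0.735 ∧ 0.537 ≤ B.Dtmin ∧ B.Cg ≤ 162 ∧ B.Dcell ≤ 3.82 := by
  obtain ⟨B, hu, hs, hA, hh, ham, hr, hc, hD⟩ :=
    klfs_exists_sharpBandBounds (a := -1) (b := -0.15) (by norm_num) (by norm_num) (by norm_num)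
  obtain ⟨h2l, h2u⟩ := klfs_num_sqrt_two
  have hd := klfs_numA_arccos_da_ge
  have hK := klfs_numA_umklappRadius_b_le
  have hK0 : 0 < umklappRadius (-0.15) := umklappRadius_pos (by norm_num)
  obtain ⟨hsl, hsu⟩ := klfs_numA_levelSin_min
  have hκ := klfs_numA_kappa_b_ge
  have hn := klfs_numA_levelN_min_ge
  have hsinc := klfs_numA_sinc_da_le
  have hsinc0 := klfs_numA_sinc_da_pos
  -- the eight fields
  have e_umin : 1.86 ≤ B.umin := by
    rw [hu]
    calc (1.86 : ℝ) ≤ 1.41421 * 1.318 := by norm_num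
      _ ≤ Real.sqrt 2 * Real.arccos (-(-1 : ℝ) / 4) := mul_le_mul h2l hd (by norm_num) (Real.sqrt_nonneg 2)
  have e_smax : B.smax ≤ 3.91 := by
    rw [hs]
    calc Real.sqrt 2 * umklappRadius (-0.15) ≤ 1.41422 * 2.76 := mul_le_mul h2u hK hK0.le (by norm_num)
      _ ≤ 3.91 := by norm_num
  have e_A2 : B.A2 ≤ 36.2 := by
    rw [hA]
    have h1 : umklappRadius (-0.15) ^ 2 /
        min (Real.sqrt (-(-1 : ℝ) * (4 + -1)) / 2) (Real.sqrt (-(-0.15 : ℝ) * (4 + -0.15)) / 2) ≤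
        2.76 ^ 2 / 0.3799 :=
      (div_le_div_of_nonneg_right (pow_le_pow_left₀ hK0.le hK 2) (by linarith)).trans
        (div_le_div_of_nonneg_left (by norm_num) (by norm_num) hsl)
    have h3 : 0 ≤ umklappRadius (-0.15) ^ 2 /
        min (Real.sqrt (-(-1 : ℝ) * (4 + -1)) / 2) (Real.sqrt (-(-0.15 : ℝ) * (4 + -0.15)) / 2) +
        2 * umklappRadius (-0.15) := by positivity
    calc Real.sqrt 2 * (umklappRadius (-0.15) ^ 2 /
          min (Real.sqrt (-(-1 : ℝ) * (4 + -1)) / 2) (Real.sqrt (-(-0.15 : ℝ) * (4 + -0.15)) / 2) +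
          2 * umklappRadius (-0.15))
        ≤ 1.41422 * (2.76 ^ 2 / 0.3799 + 2 * 2.76) := mul_le_mul h2u (by linarith) h3 (by norm_num)
      _ ≤ 36.2 := by norm_num
  have e_hmin : 0.138 ≤ B.hmin := by
    rw [hh, le_div_iff₀ (pow_pos hsinc0 2)]
    have h1 : (Real.sin (Real.arccos (-(-1 : ℝ) / 4)) / Real.arccos (-(-1 : ℝ) / 4)) ^ 2 ≤ 0.735 ^ 2 :=
      pow_le_pow_left₀ hsinc0.le hsinc 2
    calc (0.138 : ℝ) * (Real.sin (Real.arccos (-(-1 : ℝ) / 4)) / Real.arccos (-(-1 : ℝ) / 4)) ^ 2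
        ≤ 0.138 * 0.735 ^ 2 := mul_le_mul_of_nonneg_left h1 (by norm_num)
      _ ≤ 0.07489 := by norm_num
      _ ≤ _ := hn
  have e_amin : 0.0494 ≤ B.amin := by
    rw [ham]
    calc (0.0494 : ℝ) ≤ 0.02653 * (1.41421 * 1.318) := by norm_num
      _ ≤ _ := mul_le_mul hκ (mul_le_mul h2l hd (by norm_num) (Real.sqrt_nonneg 2)) (by norm_num) (by linarith)
  have e_rhomin : 0.3799 ≤ B.rhomin := by rw [hr]; exact hsl
  have e_cmax : B.cmax ≤ 0.735 := by rw [hc]; exact hsinc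
  have e_Dtmin : 0.537 ≤ B.Dtmin := by
    rw [hD]
    refine le_max_of_le_left ?_
    calc (0.537 : ℝ) ≤ 1.41421 * 0.3799 := by norm_num
      _ ≤ Real.sqrt 2 * min (Real.sqrt (-(-1 : ℝ) * (4 + -1)) / 2) (Real.sqrt (-(-0.15 : ℝ) * (4 + -0.15)) / 2) :=
          mul_le_mul h2l hsl (by norm_num) (Real.sqrt_nonneg 2)
  -- derived constants
  have e_Cg : B.Cg ≤ 162 := by
    have hπ := Real.pi_lt_d4
    have hBa : 0 < B.amin := B.amin_pos
    have hBr : 0 < B.rhomin := B.rhomin_pos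
    rw [BandBounds.Cg, div_le_iff₀ (by positivity)]
    have h1 : π * B.cmax ≤ 3.1416 * 0.735 := mul_le_mul hπ.le e_cmax B.cmax_pos.le (by norm_num)
    have h2 : (0.0494 : ℝ) * 0.3799 ^ 2 ≤ B.amin * B.rhomin ^ 2 :=
      mul_le_mul e_amin (pow_le_pow_left₀ (by norm_num) e_rhomin 2) (by norm_num) hBa.le
    have h3 : 162 * (2 * B.amin * B.rhomin ^ 2) = 324 * (B.amin * B.rhomin ^ 2) := by ring
    rw [h3]
    linarith
  have e_Dcell : B.Dcell ≤ 3.82 := by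
    rw [BandBounds.Dcell]
    have h1 : 1 / B.Dtmin ≤ 1 / 0.537 := div_le_div_of_nonneg_left (by norm_num) (by norm_num) e_Dtmin
    have h2 : (1 : ℝ) / 0.537 ≤ 1.8622 := by norm_num
    linarith
  exact ⟨B, e_umin, e_smax, e_A2, e_hmin, e_amin, e_rhomin, e_cmax, e_Dtmin, e_Cg, e_Dcell⟩

end Summit.HubbardSuperconductivity.HubbardSuperconductivity.Theorems

end
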